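import Mathlib.Combinatorics.SimpleGraph.Finite
import Mathlib.Combinatorics.SimpleGraph.Maps
import Mathlib.Data.Fintype.Card
import Mathlib.Data.Fintype.Sum
import Mathlib.Data.Fintype.Prod
import Mathlib.SetTheory.Cardinal.Finite
import Mathlib.Algebra.BigOperators.Group.Finset.Basic
import Literature.Combinatorics.SimpleGraph.ColourRefinement
import HarnessLib

/-!
# Pendant-path rigidification, I: the gadget and its colour-refinement discreteness

The folklore reduction making ANY finite graph colour-refinement-discrete without changing its
chromatic properties: to vertex `i` of a graph `G` on `Fin n` attach `hairs n i = (n+3)(i+1)`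
pendant paths, of lengths `1, 2, …, hairs n i` (path number `ℓ` has the `ℓ + 1` vertices
`(i, ℓ, 0), …, (i, ℓ, ℓ)`, the last one joined to `i`, consecutive ones joined). In the
resulting graph `rigidify G`

* original vertices have at least `n + 3 ≥ 3` neighbours, path vertices at most `2`, so no
  equitable colouring confuses the two kinds (`ne_of_orig_path`); original vertex `i` has exactly
  `hairs n i` path-neighbours, a strictly increasing function of `i`, so originals get pairwise
  distinct colours (`orig_injective`);
* along the paths, an equitable colouring determines the position (distance to the free end,
  `pos_eq_of_colour_eq`, induction on the position) and then the whole vertex (induction on the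
  distance to the original vertex, `eq_of_colour_eq_path`);

hence EVERY equitable colouring of `rigidify G` is injective: `rigidify G` is CR-discrete for
every `G` (`isCRDiscrete_rigidify`, via `isCRDiscrete_iff_forall_isEquitable_injective` of
`ColourRefinement.lean`). That `rigidify G` is 3-colourable iff `G` is, its transport to `Fin M`
and its adjacency matrix as a function of that of `G` are in `PendantPathRigidificationColour.lean`.
No printed source states this gadget; it is the standard "attach pairwise non-isomorphic rigid
trees" trick (cf. Immerman–Lander 1990, §1.9 on graphs individualised by colour refinement).

Vertices are encoded FLAT (no dependent types): `RVert n = Fin n ⊕ PathVert n`, a path vertex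
being a triple `(i, ℓ, j)` of bounded naturals with `ℓ < hairs n i` and `j ≤ ℓ`.
-/

namespace Literature.Combinatorics.SimpleGraph

open _root_.SimpleGraph Finset

/-! ## Equitable colourings: counting tools -/

section Tools

variable {V : Type*} [Finite V] {G : _root_.SimpleGraph V} {κ : Type*} {c : V → κ}

/-- Under an equitable colouring, a vertex with a neighbour of some colour forces every vertex of
its own colour to have a neighbour of that colour. [folklore] -/
theorem IsEquitable.exists_adj_of_adj (hc : IsEquitable G c) {u v : V} (huv : c u = c v) {a : V}
    (ha : G.Adj u a) : ∃ b, G.Adj v b ∧ c b = c a := by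
  have h := hc u v huv (c a)
  haveI : Nonempty {w : V // G.Adj u w ∧ c w = c a} := ⟨⟨a, ha, rfl⟩⟩
  have hpos : 0 < Nat.card {w : V // G.Adj v w ∧ c w = c a} := by
    rw [← h]; exact Nat.card_pos
  obtain ⟨⟨b, hb, hcb⟩⟩ := (Nat.card_pos_iff.1 hpos).1
  exact ⟨b, hb, hcb⟩

omit [Finite V] in
/-- `Nat.card` of a subtype of a `Fintype` is the cardinality of the filtered `univ`. [folklore] -/
private theorem natCard_eq_card_filter [Fintype V] (p : V → Prop) [DecidablePred p] :
    Nat.card {x : V // p x} = (Finset.univ.filter p).card :=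
  Nat.subtype_card _ (by simp)

/-- Under an equitable colouring, equally coloured vertices have equally many neighbours in any
set SATURATED for the colouring (a union of colour classes). [folklore] -/
theorem IsEquitable.card_adj_mem_eq (hc : IsEquitable G c) {S : Set V}
    (hS : ∀ a b : V, c a = c b → (a ∈ S ↔ b ∈ S)) {u v : V} (huv : c u = c v) :
    Nat.card {w : V // G.Adj u w ∧ w ∈ S} = Nat.card {w : V // G.Adj v w ∧ w ∈ S} := by
  classical
  haveI := Fintype.ofFinite V
  set T : Finset κ := (Finset.univ.filter fun x => x ∈ S).image c with hT
  have key : ∀ a : V, Nat.card {w : V // G.Adj a w ∧ w ∈ S} =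
      ∑ y ∈ T, Nat.card {w : V // G.Adj a w ∧ c w = y} := by
    intro a
    rw [natCard_eq_card_filter, Finset.card_eq_sum_card_fiberwise (f := c) (t := T)]
    · refine Finset.sum_congr rfl fun y hy => ?_
      rw [natCard_eq_card_filter]
      obtain ⟨x₀, hx₀, rfl⟩ := Finset.mem_image.1 hy
      simp only [Finset.mem_filter, Finset.mem_univ, true_and] at hx₀
      congr 1
      ext x
      simp only [Finset.mem_filter, Finset.mem_univ, true_and]
      exact ⟨fun h => ⟨h.1.1, h.2⟩, fun h => ⟨⟨h.1, (hS x x₀ h.2).2 hx₀⟩, h.2⟩⟩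
    · intro x hx
      rw [Finset.mem_coe, Finset.mem_filter] at hx
      exact Finset.mem_coe.2 (Finset.mem_image.2 ⟨x, by simpa using hx.2.2, rfl⟩)
  rw [key u, key v]
  exact Finset.sum_congr rfl fun y _ => hc u v huv y

/-- In particular equally coloured vertices have the same degree. [folklore] -/
theorem IsEquitable.card_adj_eq (hc : IsEquitable G c) {u v : V} (huv : c u = c v) :
    Nat.card {w : V // G.Adj u w} = Nat.card {w : V // G.Adj v w} := by
  have h := hc.card_adj_mem_eq (S := Set.univ) (fun _ _ _ => by simp) huv
  have e : ∀ a : V, {w : V // G.Adj a w ∧ w ∈ (Set.univ : Set V)} ≃ {w : V // G.Adj a w} :=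
    fun a => Equiv.subtypeEquivRight fun w => by simp
  rwa [Nat.card_congr (e u), Nat.card_congr (e v)] at h

end Tools

/-! ## The gadget -/

/-- The number of pendant paths attached to vertex `i`: `(n + 3)(i + 1)` — at least `3`, and
strictly increasing in `i`. [folklore] -/
def hairs (n : ℕ) (i : Fin n) : ℕ := (n + 3) * ((i : ℕ) + 1)

/-- A uniform bound for path numbers and positions. [folklore] -/
def hairBound (n : ℕ) : ℕ := (n + 3) * n + 1

/-- `hairs n i < hairBound n`. [folklore] -/
theorem hairs_lt_hairBound {n : ℕ} (i : Fin n) : hairs n i < hairBound n := by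
  unfold hairs hairBound
  have h : (n + 3) * ((i : ℕ) + 1) ≤ (n + 3) * n := Nat.mul_le_mul_left _ i.2
  omega

/-- `hairs` is injective. [folklore] -/
theorem hairs_injective (n : ℕ) : Function.Injective (hairs n) := by
  intro i j h
  unfold hairs at h
  apply Fin.ext
  have := Nat.eq_of_mul_eq_mul_left (by omega) h
  omega

/-- `3 ≤ hairs n i`. [folklore] -/
theorem three_le_hairs {n : ℕ} (i : Fin n) : 3 ≤ hairs n i := by
  unfold hairs
  have h : (n + 3) * 1 ≤ (n + 3) * ((i : ℕ) + 1) := Nat.mul_le_mul_left _ (by omega)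
  omega

/-- Path vertices: triples `(i, ℓ, j)` — vertex `i`, path number `ℓ < hairs n i` (the path with
`ℓ + 1` vertices), position `j ≤ ℓ` (position `0` is the free end, position `ℓ` is joined to
`i`). [folklore] -/
abbrev PathVert (n : ℕ) : Type :=
  {t : Fin n × Fin (hairBound n) × Fin (hairBound n) // (t.2.1 : ℕ) < hairs n t.1 ∧ (t.2.2 : ℕ) ≤ t.2.1}

/-- The vertices of the rigidified graph: original vertices and path vertices. [folklore] -/
abbrev RVert (n : ℕ) : Type := Fin n ⊕ PathVert n

namespace PathVert

variable {n : ℕ}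

/-- The original vertex a path hangs from. [folklore] -/
def vtx (p : PathVert n) : Fin n := p.1.1
/-- The path number. [folklore] -/
def num (p : PathVert n) : ℕ := p.1.2.1
/-- The position on the path (`0` = free end). [folklore] -/
def pos (p : PathVert n) : ℕ := p.1.2.2

/-- Extensionality for path vertices. [folklore] -/
theorem ext_iff' (p q : PathVert n) : p = q ↔ p.vtx = q.vtx ∧ p.num = q.num ∧ p.pos = q.pos := by
  constructor
  · rintro rfl; exact ⟨rfl, rfl, rfl⟩
  · rintro ⟨h1, h2, h3⟩
    apply Subtype.ext
    exact Prod.ext h1 (Prod.ext (Fin.ext h2) (Fin.ext h3))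

/-- The path vertex `(i, ℓ, j)`. [folklore] -/
def mk (i : Fin n) (ℓ j : ℕ) (hℓ : ℓ < hairs n i) (hj : j ≤ ℓ) : PathVert n :=
  ⟨(i, ⟨ℓ, hℓ.trans (hairs_lt_hairBound i)⟩, ⟨j, hj.trans_lt (hℓ.trans (hairs_lt_hairBound i))⟩),
    hℓ, hj⟩

/-- `vtx` of `mk`. [folklore] -/
@[simp] theorem vtx_mk (i : Fin n) (ℓ j : ℕ) (hℓ : ℓ < hairs n i) (hj : j ≤ ℓ) : (mk i ℓ j hℓ hj).vtx = i := rfl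
/-- `num` of `mk`. [folklore] -/
@[simp] theorem num_mk (i : Fin n) (ℓ j : ℕ) (hℓ : ℓ < hairs n i) (hj : j ≤ ℓ) : (mk i ℓ j hℓ hj).num = ℓ := rfl
/-- `pos` of `mk`. [folklore] -/
@[simp] theorem pos_mk (i : Fin n) (ℓ j : ℕ) (hℓ : ℓ < hairs n i) (hj : j ≤ ℓ) : (mk i ℓ j hℓ hj).pos = j := rfl

/-- `num < hairs`. [folklore] -/
theorem num_lt (p : PathVert n) : p.num < hairs n p.vtx := p.2.1
/-- `pos ≤ num`. [folklore] -/
theorem pos_le (p : PathVert n) : p.pos ≤ p.num := p.2.2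

end PathVert

open PathVert

variable {n : ℕ}

/-- The adjacency of the rigidified graph: `G` on the originals; original `i` joined to the top
`(i, ℓ, ℓ)` of each of its paths; consecutive path vertices `(i, ℓ, j) — (i, ℓ, j+1)`. [folklore] -/
def rigidRel (G : _root_.SimpleGraph (Fin n)) : RVert n → RVert n → Prop
  | Sum.inl i, Sum.inl i' => G.Adj i i'
  | Sum.inl i, Sum.inr p => p.vtx = i ∧ p.pos = p.num
  | Sum.inr p, Sum.inl i => p.vtx = i ∧ p.pos = p.num
  | Sum.inr p, Sum.inr q => p.vtx = q.vtx ∧ p.num = q.num ∧ (p.pos + 1 = q.pos ∨ q.pos + 1 = p.pos)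

/-- **The rigidified graph** `rigidify G` (pendant paths of pairwise distinct lengths at every
vertex). [folklore] -/
def rigidify (G : _root_.SimpleGraph (Fin n)) : _root_.SimpleGraph (RVert n) where
  Adj := rigidRel G
  symm := ⟨fun a b h => by
    cases a with
    | inl i =>
      cases b with
      | inl i' => exact h.symm
      | inr q => exact h
    | inr p =>
      cases b with
      | inl i' => exact h
      | inr q =>
        simp only [rigidRel] at h ⊢
        exact ⟨h.1.symm, h.2.1.symm, h.2.2.symm⟩⟩
  loopless := ⟨fun a h => by
    cases a with
    | inl i => exact G.irrefl h
    | inr p =>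
      simp only [rigidRel] at h
      omega⟩

variable {G : _root_.SimpleGraph (Fin n)}

/-- Adjacency of originals. [folklore] -/
@[simp] theorem rigidify_adj_inl_inl (i i' : Fin n) : (rigidify G).Adj (Sum.inl i) (Sum.inl i') ↔ G.Adj i i' :=
  Iff.rfl

/-- Adjacency original–path. [folklore] -/
@[simp] theorem rigidify_adj_inl_inr (i : Fin n) (p : PathVert n) :
    (rigidify G).Adj (Sum.inl i) (Sum.inr p) ↔ p.vtx = i ∧ p.pos = p.num := Iff.rfl

/-- Adjacency path–original. [folklore] -/
@[simp] theorem rigidify_adj_inr_inl (p : PathVert n) (i : Fin n) :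
    (rigidify G).Adj (Sum.inr p) (Sum.inl i) ↔ p.vtx = i ∧ p.pos = p.num := Iff.rfl

/-- Adjacency path–path. [folklore] -/
@[simp] theorem rigidify_adj_inr_inr (p q : PathVert n) :
    (rigidify G).Adj (Sum.inr p) (Sum.inr q) ↔
      p.vtx = q.vtx ∧ p.num = q.num ∧ (p.pos + 1 = q.pos ∨ q.pos + 1 = p.pos) := Iff.rfl

/-! ## Degrees -/

/-- An original vertex has at least `hairs n i` neighbours (the tops of its paths). [folklore] -/
theorem hairs_le_card_adj_inl (i : Fin n) : hairs n i ≤ Nat.card {w : RVert n // (rigidify G).Adj (Sum.inl i) w} := by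
  classical
  let f : Fin (hairs n i) → {w : RVert n // (rigidify G).Adj (Sum.inl i) w} := fun ℓ =>
    ⟨Sum.inr (PathVert.mk i ℓ ℓ ℓ.2 le_rfl), by simp⟩
  have hf : Function.Injective f := by
    intro a b h
    simp only [f, Subtype.mk.injEq, Sum.inr.injEq, PathVert.ext_iff', vtx_mk, num_mk, pos_mk] at h
    exact Fin.ext h.2.1
  have := Fintype.card_le_of_injective f hf
  rwa [Fintype.card_fin, ← Nat.card_eq_fintype_card] at this

/-- The neighbours of a path vertex lie among its (at most one) lower neighbour and its (one)
upper neighbour: a path vertex has at most `2` neighbours, and exactly `1` at position `0`.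
We phrase this as: the neighbour set injects into `Fin 2`, resp. `Fin 1`. [folklore] -/
theorem card_adj_inr_le (p : PathVert n) :
    Nat.card {w : RVert n // (rigidify G).Adj (Sum.inr p) w} ≤ (if p.pos = 0 then 1 else 2) := by
  classical
  -- classify a neighbour as "lower" (position `pos - 1`) or "upper"
  let g : {w : RVert n // (rigidify G).Adj (Sum.inr p) w} → Fin 2 := fun w =>
    match w with
    | ⟨Sum.inl _, _⟩ => 1
    | ⟨Sum.inr q, _⟩ => if q.pos + 1 = p.pos then 0 else 1
  have hg : Function.Injective g := by
    rintro ⟨a, ha⟩ ⟨b, hb⟩ h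
    cases a with
    | inl i =>
      cases b with
      | inl i' =>
        simp only [rigidify_adj_inr_inl] at ha hb
        have : i = i' := ha.1.symm.trans hb.1
        subst this; rfl
      | inr q =>
        simp only [rigidify_adj_inr_inl] at ha
        simp only [rigidify_adj_inr_inr] at hb
        simp only [g] at h
        exfalso
        have := q.pos_le
        split_ifs at h with hq
        · omega
        · omega
    | inr q =>
      cases b with
      | inl i' =>
        simp only [rigidify_adj_inr_inl] at hb
        simp only [rigidify_adj_inr_inr] at ha
        simp only [g] at h
        exfalso
        have := q.pos_le
        split_ifs at h with hq
        · omega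
        · omega
      | inr q' =>
        simp only [rigidify_adj_inr_inr] at ha hb
        simp only [g] at h
        have hqq : q = q' := by
          rw [PathVert.ext_iff']
          refine ⟨ha.1.symm.trans hb.1, ha.2.1.symm.trans hb.2.1, ?_⟩
          split_ifs at h with h1 h2 h2 <;> omega
        subst hqq; rfl
  split_ifs with h0
  · -- at position 0 every neighbour is "upper": inject into `Fin 1`
    let g' : {w : RVert n // (rigidify G).Adj (Sum.inr p) w} → Fin 1 := fun _ => 0
    have hg' : Function.Injective g' := by
      intro a b _
      apply hg
      have hval : ∀ w : {w : RVert n // (rigidify G).Adj (Sum.inr p) w}, g w = 1 := by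
        rintro ⟨w, hw⟩
        cases w with
        | inl i => rfl
        | inr q =>
          simp only [g]
          rw [if_neg]
          omega
      rw [hval, hval]
    have := Fintype.card_le_of_injective g' hg'
    rwa [Fintype.card_fin, ← Nat.card_eq_fintype_card] at this
  · have := Fintype.card_le_of_injective g hg
    rwa [Fintype.card_fin, ← Nat.card_eq_fintype_card] at this

/-- A path vertex at a positive position has at least two neighbours (lower and upper).
[folklore] -/
theorem two_le_card_adj_inr {p : PathVert n} (hp : 0 < p.pos) :
    2 ≤ Nat.card {w : RVert n // (rigidify G).Adj (Sum.inr p) w} := by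
  classical
  -- lower neighbour and upper neighbour
  let lo : RVert n := Sum.inr (PathVert.mk p.vtx p.num (p.pos - 1) p.num_lt (by have := p.pos_le; omega))
  let up : RVert n := if h : p.pos < p.num then
      Sum.inr (PathVert.mk p.vtx p.num (p.pos + 1) p.num_lt h) else Sum.inl p.vtx
  have hlo : (rigidify G).Adj (Sum.inr p) lo := ⟨rfl, rfl, Or.inr (Nat.sub_add_cancel hp)⟩
  have hup : (rigidify G).Adj (Sum.inr p) up := by
    simp only [up]
    split_ifs with h
    · exact ⟨rfl, rfl, Or.inl rfl⟩
    · exact ⟨rfl, le_antisymm p.pos_le (not_lt.1 h)⟩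
  have hne : lo ≠ up := by
    simp only [lo, up]
    split_ifs with h
    · simp only [Ne, Sum.inr.injEq, PathVert.ext_iff', vtx_mk, num_mk, pos_mk]; omega
    · exact Sum.inr_ne_inl
  let f : Fin 2 → {w : RVert n // (rigidify G).Adj (Sum.inr p) w} := fun k =>
    if (k : ℕ) = 0 then ⟨lo, hlo⟩ else ⟨up, hup⟩
  have hf : Function.Injective f := by
    intro a b h
    simp only [f] at h
    apply Fin.ext
    split_ifs at h with h1 h2 h2
    · omega
    · exact absurd (congrArg Subtype.val h) hne
    · exact absurd (congrArg Subtype.val h).symm hne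
    · omega
  have := Fintype.card_le_of_injective f hf
  rwa [Fintype.card_fin, ← Nat.card_eq_fintype_card] at this

/-- A path vertex at position `0` has exactly one neighbour, so (by the previous lemma) the
neighbour count distinguishes position `0` from positive positions. [folklore] -/
theorem card_adj_inr_pos_zero {p : PathVert n} (hp : p.pos = 0) :
    Nat.card {w : RVert n // (rigidify G).Adj (Sum.inr p) w} ≤ 1 := by
  simpa [hp] using card_adj_inr_le (G := G) p

end Literature.Combinatorics.SimpleGraph
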